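import Mathlib.Algebra.BigOperators.Group.Finset.Basic
import Mathlib.Data.Countable.Basic
import Mathlib.Data.Set.Finite.Basic
import Literature.AlgebraicGeometry.Frobenioids.RlfStructureWeak
import Literature.AnabelianGeometry.EtaleTheta.RealificationOrderWeak
import Literature.AnabelianGeometry.EtaleTheta.DivisorMonoidsCuspidalWeak
import Literature.AnabelianGeometry.EtaleTheta.SubmonoidPerfection
import Literature.AnabelianGeometry.EtaleTheta.MonoprimeStructure

/-!
# Additive functionals on a weakly perf-factorial monoid with cofinal perfection are carried by primes
# (the "no phantom support" phenomenon behind [EtTh] Cor. 3.8 (iii), countable case)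

Mochizuki, *The étale theta function …*, Publ. RIMS **45** (2009), proof of Cor. 3.8 (iii), PDF p.82
(printed 308) [cite: MochizukiEtTh2009, Cor 3.8 p.82]: a pre-step is non-cuspidal (resp. cuspidal) iff so
are its primary components — "by considering the factorization homomorphisms … [cf. the fact that `Φ` is
perf-factorial]"; [FrdI] Def. 2.4 (i)(c)(d), kurims p.47 [cite: MochizukiFrdI2008, Def. 2.4(i) p.47].

abc-iut cell, F-L2d2-1 / F-L2d2-2 repair chain (seat abc-iut-L2-d2).  In the tree, the support reading of
(non-)cuspidality for a tempered Frobenioid over the realified data `ofRlfZ(Weak)` needs the hypothesis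
(R3) "no phantom support" (gen-2 of this seat, `Sec3Cor38iiiOfRlf.lean`; abc-iut-L6-t12): every prime of
`Φ₀(Y)^rlf` in the support of `x ∈ Φ(A)` lies in the support of some PRIMARY `y ≼ x` of `Φ(A)` — i.e.
the `𝔮`-coordinate `λ_𝔮 : Φ(A)^pf → ℝ≥0` of the ambient realification, an additive functional, does not
vanish on all primary components of `x` when `λ_𝔮(x) ≠ 0`.  For the cell's WEAK notion this is NOT
automatic in general (an additive functional on `P^pf` may be a "phantom", e.g. an ultrafilter limit),
but it IS a theorem when `P^pf` is cofinal in `P^rlf` ((d_cof), `IsPerfFactorialCof`) and `P^pf` has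
COUNTABLY many primes (the geometric case: special-fibre components indexed by `ℤ`, finitely many cusps):

* `IsPerfFactorialWeak.exists_prime_restrict_ne_one`: for `h : IsPerfFactorialWeak P` with cofinal `P^pf`,
  `Primes (P^pf)` countable, ANY monoid homomorphism `λ : P^pf → ℝ≥0` and `b ∈ P^pf` with `λ b ≠ 0`, some
  single-prime restriction `b|_{𝔭}` ((d_res)) already has `λ (b|_{𝔭}) ≠ 0`;
* `IsPerfFactorialWeak.exists_isPrimary_precsim_mem_supp`: (R3) DISCHARGED for countably many primes — for
  a weakly perf-factorial submonoid `P` with cofinal perfection of the weak realification `M^rlf` of a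
  weakly perf-factorial `M`, every prime `𝔮` of `M^pf` in the support of `x ∈ P` lies in the support of
  some PRIMARY `y ≼ x` of `P` (the hypothesis `hR3` of `cor38_iii_ofRlfZ(Weak)`).

Proof (this seat): otherwise every finite-prime part of `b` is `λ`-null, so `λ b = λ (b|_{T_n})` for the
tails `T_n = {𝔭 | f 𝔭 ≥ n}` of an injection `f : Primes → ℕ`; the pattern `X := (b_𝔭^{f 𝔭})_𝔭 ∈ P^rlf` lies
below some `b' ∈ P^pf` by COFINALITY, and `X ≥ (b|_{T_n})^n` gives `n · λ b ≤ λ b'` for every `n` —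
absurd.  (Without cofinality, or with uncountably many primes carrying a countably complete ultrafilter,
the statement can fail; neither occurs for the divisor monoids of [EtTh].)  Theorems only.  HONEST FRAMING:
classical monoid algebra; nothing here bears on [IUTchIII] Cor. 3.12.
-/

namespace Literature.AlgebraicGeometry.Frobenioids

open Function NNReal
open Literature.AnabelianGeometry.EtaleTheta

universe u

namespace IsPerfFactorialWeak

variable {P : Type u} [CommMonoid P]

/-- (d_res) with the two defining clauses spelled out: the restriction of `b ∈ P^pf` to a set of primes.
[cite: MochizukiFrdI2008, Def. 2.4(i) p.47] -/
private theorem exists_restrict_spec (h : IsPerfFactorialWeak P) (b : Perfection P)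
    (S : Set (Primes (Perfection P))) :
    ∃ c : Perfection P, ∀ 𝔮, (𝔮 ∈ S → factorMap P c 𝔮 = factorMap P b 𝔮) ∧ (𝔮 ∉ S → factorMap P c 𝔮 = 1) :=
  h.exists_restrict b S

/-- **Additive functionals on `P^pf` are carried by primes** (weakly perf-factorial `P` with COFINAL
perfection and countably many primes): if `λ : P^pf → ℝ≥0` is a monoid homomorphism and `λ b ≠ 0`, then
`λ (b|_{𝔭}) ≠ 0` for the restriction `b|_{𝔭}` of `b` to some single prime `𝔭` ((d_res)).  This is the
monoid-theoretic content of "no phantom support" ([EtTh] Cor. 3.8 (iii), proof p.82: "by considering the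
factorization homomorphisms"). [cite: MochizukiEtTh2009, Cor 3.8 p.82] -/
theorem exists_prime_restrict_ne_one (h : IsPerfFactorialWeak P)
    (hcof : ∀ x : h.Rlf, ∃ b : Perfection P, x ∣ h.toRealification b)
    [Countable (Primes (Perfection P))] (lam : Perfection P →* Multiplicative ℝ≥0)
    {b : Perfection P} (hb : lam b ≠ 1) :
    ∃ (𝔭 : Primes (Perfection P)) (c : Perfection P),
      (∀ 𝔮, (𝔮 = 𝔭 → factorMap P c 𝔮 = factorMap P b 𝔮) ∧ (𝔮 ≠ 𝔭 → factorMap P c 𝔮 = 1)) ∧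
        lam c ≠ 1 := by
  classical
  by_contra H
  push Not at H
  -- the restrictions `r S = b|_S` ((d_res))
  choose r hr using fun S : Set (Primes (Perfection P)) => exists_restrict_spec h b S
  have hr_mem : ∀ S 𝔮, 𝔮 ∈ S → factorMap P (r S) 𝔮 = factorMap P b 𝔮 := fun S 𝔮 => (hr S 𝔮).1
  have hr_nmem : ∀ S 𝔮, 𝔮 ∉ S → factorMap P (r S) 𝔮 = 1 := fun S 𝔮 => (hr S 𝔮).2
  -- every single-prime restriction is `λ`-null
  have h1 : ∀ 𝔭, lam (r {𝔭}) = 1 := fun 𝔭 =>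
    H 𝔭 (r {𝔭}) fun 𝔮 => ⟨fun e => hr_mem {𝔭} 𝔮 (Set.mem_singleton_iff.mpr e),
      fun ne => hr_nmem {𝔭} 𝔮 (fun hm => ne (Set.mem_singleton_iff.mp hm))⟩
  -- an injection of the primes into `ℕ`; heads `F n` (finite) and tails `T n`
  obtain ⟨f, hf⟩ := Countable.exists_injective_nat (Primes (Perfection P))
  let T : ℕ → Set (Primes (Perfection P)) := fun n => {𝔭 | n ≤ f 𝔭}
  let F : ℕ → Set (Primes (Perfection P)) := fun n => {𝔭 | f 𝔭 < n}
  have hFfin : ∀ n, (F n).Finite := fun n =>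
    (Set.finite_Iio n).preimage hf.injOn
  -- `b = b|_{T n} · b|_{F n}`
  have hsplit : ∀ n, b = r (T n) * r (F n) := by
    intro n
    apply h.factorMap_injective
    rw [h.factorMap_mul]
    funext 𝔮
    rw [Pi.mul_apply]
    by_cases hle : n ≤ f 𝔮
    · rw [hr_mem (T n) 𝔮 hle, hr_nmem (F n) 𝔮 (fun hlt => absurd hlt (not_lt.mpr hle)), mul_one]
    · rw [hr_nmem (T n) 𝔮 hle, hr_mem (F n) 𝔮 (not_le.mp hle), one_mul]
  -- `b|_{F n}` is the (finite) product of the single-prime restrictions, hence `λ`-null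
  have hFprod : ∀ n, r (F n) = ∏ 𝔭 ∈ (hFfin n).toFinset, r {𝔭} := by
    intro n
    apply h.factorMap_injective
    change h.factorHom (r (F n)) = h.factorHom (∏ 𝔭 ∈ (hFfin n).toFinset, r {𝔭})
    rw [map_prod]
    funext 𝔮
    rw [Finset.prod_apply]
    simp only [IsPerfFactorialWeak.factorHom_apply]
    have hterm : ∀ 𝔭 ∈ (hFfin n).toFinset, factorMap P (r {𝔭}) 𝔮 =
        if 𝔮 = 𝔭 then factorMap P b 𝔮 else 1 := by
      intro 𝔭 _
      by_cases e : 𝔮 = 𝔭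
      · rw [if_pos e, hr_mem {𝔭} 𝔮 (Set.mem_singleton_iff.mpr e)]
      · rw [if_neg e, hr_nmem {𝔭} 𝔮 (fun hm => e (Set.mem_singleton_iff.mp hm))]
    rw [Finset.prod_congr rfl hterm, Finset.prod_ite_eq]
    by_cases h𝔮 : 𝔮 ∈ F n
    · rw [hr_mem (F n) 𝔮 h𝔮, if_pos ((hFfin n).mem_toFinset.mpr h𝔮)]
    · rw [hr_nmem (F n) 𝔮 h𝔮, if_neg (fun hm => h𝔮 ((hFfin n).mem_toFinset.mp hm))]
  have hF1 : ∀ n, lam (r (F n)) = 1 := by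
    intro n
    rw [hFprod, map_prod]
    exact Finset.prod_eq_one fun 𝔭 _ => h1 𝔭
  have hT : ∀ n, lam (r (T n)) = lam b := by
    intro n
    conv_rhs => rw [hsplit n, map_mul, hF1 n, mul_one]
  -- the blow-up pattern `X_𝔭 := b_𝔭^{f 𝔭}`, an element of `P^rlf`
  let X : RlfFactor P := fun 𝔮 => factorMap P b 𝔮 ^ (f 𝔮)
  have hXmem : X ∈ h.realification := by
    refine ⟨b, fun 𝔮 h𝔮 hb𝔮 => h𝔮 ?_⟩
    show factorMap P b 𝔮 ^ (f 𝔮) = 1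
    rw [hb𝔮, one_pow]
  -- COFINALITY: `X ≤ b'` for some `b' ∈ P^pf`
  obtain ⟨b', hb'⟩ := hcof ⟨X, hXmem⟩
  -- `(b|_{T n})^n ≤ X ≤ b'`, hence `n · λ b ≤ λ b'`
  have hmono := RlfCoordWeak.isMonoprime_pfAt h
  have hle : ∀ n : ℕ, n * Multiplicative.toAdd (lam b) ≤ Multiplicative.toAdd (lam b') := by
    intro n
    have hdvdX : h.toRealification (r (T n) ^ n) ∣ (⟨X, hXmem⟩ : h.Rlf) := by
      rw [IsPerfFactorialWeak.Rlf.dvd_iff]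
      intro 𝔮
      show factorMap P (r (T n) ^ n) 𝔮 ∣ factorMap P b 𝔮 ^ (f 𝔮)
      rw [← h.factorHom_apply, map_pow, Pi.pow_apply, h.factorHom_apply]
      by_cases hle : n ≤ f 𝔮
      · rw [hr_mem (T n) 𝔮 hle]
        exact pow_dvd_pow _ hle
      · rw [hr_nmem (T n) 𝔮 hle, one_pow]
        exact one_dvd _
    have hdvd : r (T n) ^ n ∣ b' :=
      (RlfCoordWeak.toRealification_dvd_iff h hmono _ _).mp (hdvdX.trans hb')
    have hlam := map_dvd lam hdvd
    rw [map_pow, hT n, RealificationCoord.mnnreal_dvd_iff_le] at hlam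
    have := (RealificationCoord.mnnreal_le_iff _ _).mp hlam
    rwa [toAdd_pow, nsmul_eq_mul] at this
  -- contradiction with `λ b ≠ 0`
  have hpos : 0 < Multiplicative.toAdd (lam b) := by
    rw [pos_iff_ne_zero]
    intro h0
    exact hb (Multiplicative.toAdd.injective (by rw [h0, toAdd_one]))
  obtain ⟨n, hn⟩ := exists_nat_gt (Multiplicative.toAdd (lam b') / Multiplicative.toAdd (lam b))
  have : Multiplicative.toAdd (lam b') < n * Multiplicative.toAdd (lam b) := by
    rwa [div_lt_iff₀ hpos] at hn
  exact absurd (hle n) (not_le.mpr this)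

/-! ### (R3) "no phantom support" for submonoids of a weak realification, countable case -/

/-- In `Multiplicative ℝ≥0`, an element dividing `1` is `1`. [folklore] -/
private theorem mnnreal_eq_one_of_dvd_one {a : Multiplicative ℝ≥0} (h : a ∣ 1) : a = 1 :=
  le_antisymm ((RealificationCoord.mnnreal_dvd_iff_le _ _).mp h) one_le

/-- **(R3) "no phantom support", DISCHARGED for countably many primes.**  Let `M` be weakly perf-factorial,
`P ⊆ M^rlf` a submonoid of its (weak) realification which is itself weakly perf-factorial with cofinal
perfection and has countably many primes.  Then every prime `𝔮` of `M^pf` occurring in the support of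
`x ∈ P` occurs in the support of some PRIMARY element `y ≼ x` of `P` — the hypothesis `hR3` of the cell's
`cor38_iii_ofRlfZ` / `cor38_iii_ofRlfZWeak` ([EtTh] Cor. 3.8 (iii), proof p.82: the support of a divisor is
read off its primary components "by considering the factorization homomorphisms").  Proof: apply
`exists_prime_restrict_ne_one` to the `𝔮`-coordinate of `M^rlf` pulled back to `P^pf`, then pass from the
single-prime restriction `x|_{𝔭}` to a primary `y ≼ x` of class `𝔭` ([FrdI] Def. 2.4 (i)(c)), which
dominates a root of `x|_{𝔭}` inside the monoprime `P^pf_𝔭`. [cite: MochizukiEtTh2009, Cor 3.8 p.82] -/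
theorem exists_isPrimary_precsim_mem_supp {M : Type u} [CommMonoid M] (hW : IsPerfFactorialWeak M)
    (P : Submonoid hW.Rlf) (hP : IsPerfFactorialWeak P)
    (hcof : ∀ x : hP.Rlf, ∃ b : Perfection P, x ∣ hP.toRealification b)
    [Countable (Primes (Perfection P))] {x : P} {𝔮 : Primes (Perfection M)}
    (h𝔮 : 𝔮 ∈ supp ((x : hW.Rlf) : RlfFactor M)) :
    ∃ y : P, IsPrimary y ∧ Precsim y x ∧ 𝔮 ∈ supp ((y : hW.Rlf) : RlfFactor M) := by
  classical
  -- the inclusion `P^pf → M^rlf` (`M^rlf` is perfect) and the `𝔮`-coordinate `λ : P^pf → ℝ≥0`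
  obtain ⟨ι, hι⟩ := Lemma35.exists_extension P (IsPerfFactorialWeak.Rlf.isPerfect hW)
  obtain ⟨fq⟩ := RealificationCoord.nonempty_coord (RlfCoordWeak.isMonoprime_pfAt hW 𝔮)
  let ev : hW.Rlf →* RlfAt M 𝔮 :=
    (Pi.evalMonoidHom (fun 𝔮' : Primes (Perfection M) => RlfAt M 𝔮') 𝔮).comp hW.realification.subtype
  let lam : Perfection P →* Multiplicative ℝ≥0 := (fq.toMonoidHom.comp ev).comp ι
  have hlam : ∀ z : P, lam (Perfection.of P z) = fq (((z : hW.Rlf) : RlfFactor M) 𝔮) := by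
    intro z
    have hz : ι (Perfection.of P z) = (z : hW.Rlf) := DFunLike.congr_fun hι z
    show fq (ev (ι (Perfection.of P z))) = _
    rw [hz]
    rfl
  have hsupp : ∀ z : P, 𝔮 ∈ supp ((z : hW.Rlf) : RlfFactor M) ↔ lam (Perfection.of P z) ≠ 1 := by
    intro z
    rw [hlam, ne_eq, EmbeddingLike.map_eq_one_iff]
    rfl
  -- the core: some single-prime restriction of `x` is `λ`-positive
  obtain ⟨𝔭, c, hc, hcne⟩ := hP.exists_prime_restrict_ne_one hcof lam ((hsupp x).1 h𝔮)
  -- hence the factorization of `x` is nonzero at `𝔭` …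
  have hx𝔭 : factorMap P (Perfection.of P x) 𝔭 ≠ 1 := by
    intro h0
    apply hcne
    have hc1 : c = 1 := hP.factorMap_injective (by
      rw [hP.factorMap_one]
      funext 𝔮'
      by_cases e : 𝔮' = 𝔭
      · rw [(hc 𝔮').1 e, e, h0, Pi.one_apply]
      · rw [(hc 𝔮').2 e, Pi.one_apply])
    rw [hc1, map_one]
  -- … so some primary `y` of class `𝔭` lies below `x` ([FrdI] Def. 2.4 (i)(c))
  obtain ⟨y, hy, hy𝔭, hyx⟩ := hP.exists_isPrimary_precsim_of_factorMap_ne_one hx𝔭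
  refine ⟨y, hy, hyx, (hsupp y).2 fun hy1 => hcne ?_⟩
  -- `c = x|_{𝔭}` divides a power of `y` in `P^pf`: compare inside the monoprime `P^pf_𝔭`
  obtain ⟨w, hw⟩ := hP.factorMap_mem_range (Perfection.of P x)
  let p : PfAt P 𝔭 := ⟨Perfection.of P y, Submonoid.subset_closure hy𝔭⟩
  have hp1 : p ≠ 1 := fun e => hy𝔭.1.1 (congrArg Subtype.val e)
  obtain ⟨k, -, ⟨d, hd⟩⟩ :=
    MonoprimeStructure.precsim_of_ne_one (RlfCoordWeak.isMonoprime_pfAt hP 𝔭) (a := w 𝔭) hp1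
  have hfy : factorMap P (Perfection.of P y) = pfFactorToRlfFactor P (Pi.mulSingle 𝔭 p) :=
    hP.factorMap_coe_pfAt 𝔭 p
  have hdvd : c ∣ Perfection.of P y ^ k := by
    refine hP.dvd_of_factorMap_mul_eq (x := Pi.mulSingle 𝔭 d) ?_
    rw [← hP.factorHom_apply (Perfection.of P y ^ k), map_pow, hP.factorHom_apply, hfy, ← map_pow]
    funext 𝔮'
    rw [Pi.mul_apply, pfFactorToRlfFactor_apply, pfFactorToRlfFactor_apply]
    by_cases e : 𝔮' = 𝔭
    · subst e
      rw [(hc 𝔮').1 rfl, ← hw, pfFactorToRlfFactor_apply, Pi.mulSingle_eq_same, Pi.pow_apply,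
        Pi.mulSingle_eq_same, hd, map_mul]
    · rw [(hc 𝔮').2 e, Pi.mulSingle_eq_of_ne e, Pi.pow_apply, Pi.mulSingle_eq_of_ne e, one_pow,
        map_one, one_mul]
  have := map_dvd lam hdvd
  rw [map_pow, hy1, one_pow] at this
  exact mnnreal_eq_one_of_dvd_one this

end IsPerfFactorialWeak

end Literature.AlgebraicGeometry.Frobenioids
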